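import Summits.CriticalPhenomena.Ising3DConformalLimit.Theorems.FKParityRobustnessIndependentStrandsJoinEventuallyUpgrade
import Summits.CriticalPhenomena.Ising3DConformalLimit.Theorems.FKParityRobustnessIndependentStrandsJoinNonGaussianResidual
import HarnessLib

/-!
# Strategy sketch s8 (crux-strategist, independent census family `s`) for the crux
# `IndependentStrandsJoin` (stmt-CriticalPhenomena-14625, route `FKParityRobustness`)

Scratch typing of the candidate SWITCHES examined in `STRATEGY-CENSUS-s8.md`.  Nothing here is a
registered line; every `theorem` below is sorry-free and records which implications among the
candidates are ALREADY formal, so that the census can say precisely which piece of each candidate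
split carries the whole crux.

* `MergingFloorAt x`      — eventual far merging of the critical Ursell function along the integer
                            dilations of a lattice 4-tuple `x` (the crux is `MergingFloorAt tetra`,
                            `mergingFloorAt_tetra_iff`).
* `rectShape h`           — the parallel-pairs rectangle `((−1,0,0),(1,0,0),(−1,0,h),(1,0,h))`.
* `AspectTransfer h`      — candidate decomposition piece: merging at the rectangle of height `h`
                            transfers to the tetrahedron.
* `NonGaussianMoebius`    — candidate weaker intermediate (W2): every Möbius-covariant non-degenerate
                            limit has `U₄ ≢ 0`; weaker than the crux (`nonGaussianMoebius_of_isj`) and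
                            still closing WITH `MoebiusLimit` (`summit_of_nonGaussianMoebius`) — a
                            route-level re-glue, not a line.
* `TetraGaussian`         — the negation target: `R₄(A_l) → 0` refutes the crux
                            (`not_isj_of_tetraGaussian`).
-/

noncomputable section

open Filter Topology Finset
open Literature.Probability.LatticeModels
open Summit.CriticalPhenomena.Ising3DConformalLimit.Theses.FKParityRobustness
open Summit.CriticalPhenomena.Ising3DConformalLimit.Cruxes.ParityRobustMerging.PlaquetteXorSurgery (tetra)
open Summit.CriticalPhenomena.Ising3DConformalLimit.Cruxes.IndependentStrandsJoin.PinchToTetra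

namespace Summit.CriticalPhenomena.Ising3DConformalLimit.Cruxes.IndependentStrandsJoin.StrategyS8

/-! ## General-shape merging floors -/

/-- The critical lattice Ursell function at a 4-tuple `y` of sites of `ℤ³`. -/
def U4at (y : Fin 4 → Site 3) : ℝ :=
  criticalCorr 3 4 y -
    (criticalCorr 3 2 ![y 0, y 1] * criticalCorr 3 2 ![y 2, y 3] +
      criticalCorr 3 2 ![y 0, y 2] * criticalCorr 3 2 ![y 1, y 3] +
      criticalCorr 3 2 ![y 0, y 3] * criticalCorr 3 2 ![y 1, y 2])

/-- Aizenman's normalisation `⟨σ_{y₀}σ_{y₁}⟩⟨σ_{y₂}σ_{y₃}⟩` (the two SOURCED pairs). -/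
def GGat (y : Fin 4 → Site 3) : ℝ :=
  criticalCorr 3 2 ![y 0, y 1] * criticalCorr 3 2 ![y 2, y 3]

/-- Eventual far merging along the integer dilations of the shape `x`:
`∃ c > 0, ∀ large l, U₄(l·x) ≤ −c·⟨σσ⟩⟨σσ⟩(l·x)`. -/
def MergingFloorAt (x : Fin 4 → Site 3) : Prop :=
  ∃ c : ℝ, 0 < c ∧ ∃ l₁ : ℕ, ∀ l : ℕ, l₁ ≤ l →
    U4at (fun i => (l : ℤ) • x i) ≤ -(c * GGat (fun i => (l : ℤ) • x i))

/-- At the regular tetrahedron this is literally `TetraMergingEventually`. -/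
theorem mergingFloorAt_tetra_iff : MergingFloorAt tetra ↔ TetraMergingEventually := Iff.rfl

/-- Hence the crux IS `MergingFloorAt tetra` (landed limit-free upgrade). -/
theorem isj_iff_mergingFloorAt_tetra : IndependentStrandsJoin ↔ MergingFloorAt tetra :=
  independentStrandsJoin_iff_tetraMergingEventually

/-! ## Candidate decomposition D2: parallel pairs + aspect transfer -/

/-- The parallel-pairs rectangle of height `h`: sourced pairs `{(−1,0,0),(1,0,0)}` and
`{(−1,0,h),(1,0,h)}`. -/
def rectShape (h : ℕ) : Fin 4 → Site 3 := ![![-1, 0, 0], ![1, 0, 0], ![-1, 0, (h : ℤ)], ![1, 0, (h : ℤ)]]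

/-- Candidate piece: merging at the height-`h` rectangle transfers to the regular tetrahedron. -/
def AspectTransfer (h : ℕ) : Prop := MergingFloorAt (rectShape h) → MergingFloorAt tetra

/-- The assembly of D2 is trivial (modus ponens + the landed upgrade); recorded so the census can
say that ALL difficulty sits in the two pieces, and that piece 2 has no tool. -/
theorem isj_of_rect_and_transfer (h : ℕ) :
    MergingFloorAt (rectShape h) → AspectTransfer h → IndependentStrandsJoin :=
  fun hr ht => isj_iff_mergingFloorAt_tetra.2 (ht hr)

/-! ## Candidate weaker intermediate W2: non-Gaussianity of MÖBIUS-covariant limits only -/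

/-- W2: every Möbius-covariant non-degenerate pointwise scaling limit of the critical correlators
of `ℤ³` has a non-trivial connected four-point function. -/
def NonGaussianMoebius : Prop :=
  ∀ (ρ : ℝ → ℝ) (Δ : ℝ) (S : CorrFamily 3), (∀ δ ∈ Set.Ioc (0:ℝ) 1, 0 < ρ δ) → 0 < Δ →
    HasPointwiseScalingLimit (criticalCorr 3) ρ S → IsNondegenerateTwoPoint S →
    IsMoebiusCovariant Δ S → HasNontrivialU4 S

/-- W2 is weaker than the route support `NonGaussianLimit` (item 0636) … -/
theorem nonGaussianMoebius_of_nonGaussianLimit : NonGaussianLimit → NonGaussianMoebius :=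
  fun h ρ _Δ S hρ _hΔ hlim hnd _hcov => h ρ S hρ hlim hnd

/-- … hence weaker than the crux (landed `nonGaussianLimit_of_independentStrandsJoin`). -/
theorem nonGaussianMoebius_of_isj : IndependentStrandsJoin → NonGaussianMoebius :=
  fun h => nonGaussianMoebius_of_nonGaussianLimit (nonGaussianLimit_of_independentStrandsJoin h)

/-- … and it still closes the sub-problem together with the route's imported complement
`MoebiusLimit` — but only AT ROUTE LEVEL (it replaces the binder of `closes`; it is not a line for
the unconditional lattice crux). -/
theorem summit_of_nonGaussianMoebius :
    NonGaussianMoebius → MoebiusLimit → _root_.Ising3DConformalLimit := by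
  intro hW hM
  obtain ⟨ρ, Δ, S, hρ, hΔ, hlim, hnd, hcov⟩ := hM
  exact ⟨ρ, Δ, S, hρ, hΔ, hlim, hnd, hcov, hW ρ Δ S hρ hΔ hlim hnd hcov⟩

/-- Conversely the summit gives W2 only for ITS OWN limit; W2 for every covariant limit would need
uniqueness of the limit up to the renormalisation — not in tree.  (Recorded as the reason W2 is
"conjunct-strength": it is clause (iii) restricted to covariant limits.) -/
theorem summit_of_moebius_and_W2_iff :
    (MoebiusLimit ∧ NonGaussianMoebius) → _root_.Ising3DConformalLimit :=
  fun h => summit_of_nonGaussianMoebius h.2 h.1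

/-! ## Negation target -/

/-- Tetrahedral Gaussianity: the merging ratio of the regular tetrahedra tends to zero. -/
def TetraGaussian : Prop := Tendsto R4ratio atTop (𝓝 0)

/-- A counterexample to the crux is exactly (at least) `liminf R₄(A_l) = 0`; in particular
`TetraGaussian` refutes it. -/
theorem not_isj_of_tetraGaussian : TetraGaussian → ¬ IndependentStrandsJoin := by
  intro hT hI
  obtain ⟨c, hc, l₁, h⟩ := independentStrandsJoin_iff_R4ratio.1 hI
  obtain ⟨l₂, hl₂⟩ := Filter.eventually_atTop.1 ((tendsto_order.1 hT).2 c hc)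
  have h1 := h (max l₁ l₂) (le_max_left _ _)
  have h2 := hl₂ (max l₁ l₂) (le_max_right _ _)
  linarith


/-! ## Candidate decomposition D3 (the route header's foreseen `StrandMass → StrandQuasiMult` split, typed):
Paley–Zygmund on the number `N` of common vertices of the two source clusters.  Piece A is the
`d = 3`-specific fatness input (`2·D_HT > 3`, margin 0.47 numerically; no tool), piece B the structural
quasi-multiplicativity of the odd strand (no switching partner).  The assembly `A → B → crux` is the
standard second-moment inequality plus `{N > 0} ⊆ {a₀ ~ a₂ in F₁ ∪ F₂}`; it is stated here as a `Prop`
(NOT proved in this sketch — it is an M-sized formalisation, and the census does not file the split). -/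

open Classical in
/-- Number of box vertices reachable from `x` in `F₁` AND from `y` in `F₂` (the meeting count `N`). -/
def meetCount {N : ℕ} (F₁ F₂ : Finset (Sym2 ↥(box 3 N))) (x y : ↥(box 3 N)) : ℕ :=
  (Finset.univ.filter fun u : ↥(box 3 N) =>
    (SimpleGraph.fromEdgeSet (↑F₁ : Set (Sym2 ↥(box 3 N)))).Reachable x u ∧
    (SimpleGraph.fromEdgeSet (↑F₂ : Set (Sym2 ↥(box 3 N)))).Reachable y u).card

/-- Piece A (`StrandMass`-type first-moment floor): `E_{ℓ⊗ℓ}[N] ≥ c` uniformly in the scale — the two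
independent critical strands of the tetrahedron share `≥ c` vertices ON AVERAGE.  (Where `2·D_HT > 3`
enters; open, no tool: the only known one-point bound on the odd strand is the UPPER one
`p(u) ≤ τ(a₀u)τ(ua₁)/τ(a₀a₁)` by switching.) -/
def FirstMomentFloor : Prop :=
  ∃ c : ℝ, 0 < c ∧ ∀ l : ℕ, 1 ≤ l → ∃ N₀ : ℕ, ∀ N : ℕ, N₀ ≤ N → ∀ a : Fin 4 → ↥(box 3 N),
    (∀ i, ((a i : Site 3)) = (l : ℤ) • tetra i) →
    (let G := ((zdGraph 3).comap (Subtype.val : ↥(box 3 N) → Site 3))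
     let t : ℝ := Real.tanh (criticalBeta 3)
     c * loopO1PartitionFunction G t {a 0, a 1} * loopO1PartitionFunction G t {a 2, a 3} ≤
       ∑ F₁ ∈ tJoins G Set.univ {a 0, a 1}, ∑ F₂ ∈ tJoins G Set.univ {a 2, a 3},
         t ^ (F₁.card + F₂.card) * (meetCount F₁ F₂ (a 0) (a 2) : ℝ))

/-- Piece B (`StrandQuasiMult`-type second-moment bound): `E[N²] ≤ C·(E[N]² + E[N])` uniformly in the
scale (cleared of denominators).  Structural; open for the odd strand (no switching partner for pair
densities of `V(K)`). -/
def SecondMomentBound : Prop :=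
  ∃ C : ℝ, ∀ l : ℕ, 1 ≤ l → ∃ N₀ : ℕ, ∀ N : ℕ, N₀ ≤ N → ∀ a : Fin 4 → ↥(box 3 N),
    (∀ i, ((a i : Site 3)) = (l : ℤ) • tetra i) →
    (let G := ((zdGraph 3).comap (Subtype.val : ↥(box 3 N) → Site 3))
     let t : ℝ := Real.tanh (criticalBeta 3)
     let Z : ℝ := loopO1PartitionFunction G t {a 0, a 1} * loopO1PartitionFunction G t {a 2, a 3}
     let S₁ : ℝ := ∑ F₁ ∈ tJoins G Set.univ {a 0, a 1}, ∑ F₂ ∈ tJoins G Set.univ {a 2, a 3},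
         t ^ (F₁.card + F₂.card) * (meetCount F₁ F₂ (a 0) (a 2) : ℝ)
     let S₂ : ℝ := ∑ F₁ ∈ tJoins G Set.univ {a 0, a 1}, ∑ F₂ ∈ tJoins G Set.univ {a 2, a 3},
         t ^ (F₁.card + F₂.card) * ((meetCount F₁ F₂ (a 0) (a 2) : ℝ) ^ 2)
     Z * S₂ ≤ C * (S₁ ^ 2 + Z * S₁))

/-- The D3 assembly, as a statement (Paley–Zygmund: `P[N>0] ≥ E[N]²/E[N²] ≥ c²/(C(c²+c))`, and
`N > 0 ⟹ a₀ ~ a₂ in F₁ ∪ F₂`).  Provable by elementary finite-sum algebra; not proved here. -/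
def AssemblyPZ : Prop := FirstMomentFloor → SecondMomentBound → IndependentStrandsJoin

/-! ## Strengthenings (S⁺) -/

/-- S⁺⁺: far merging along the dilations of EVERY non-degenerate lattice 4-tuple (all shapes). -/
def AllShapesMerging : Prop := ∀ x : Fin 4 → Site 3, Function.Injective x → MergingFloorAt x

/-- S⁺⁺ gives the crux (specialise to the tetrahedron). -/
theorem isj_of_allShapesMerging (h : AllShapesMerging) : IndependentStrandsJoin :=
  isj_iff_mergingFloorAt_tetra.2 (h tetra (by
    intro i j hij
    fin_cases i <;> fin_cases j <;> simp_all [tetra]))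

end Summit.CriticalPhenomena.Ising3DConformalLimit.Cruxes.IndependentStrandsJoin.StrategyS8
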